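import Literature.MathematicalPhysics.QuantumManyBody.DyadicCoherentFraction
import Mathlib.Analysis.SpecialFunctions.Pow.NNReal
import HarnessLib

/-!
# Crux `BECTangentRigidity.TangentTransfer` (stmt-AtomisticToContinuum-13033), line `registered` (v2):
# STUB `stub_baseAmplitude` — the coherent amplitude from a floor and a no-clumping bound

Deterministic `ℝ≥0∞` algebra.  At a dyadic level `k` write `n_m = ⟨dyMode L k m, γ_Ψ dyMode L k m⟩`
for the occupations of the `8^k` flat cell modes, `T = Σ_m n_m = cohSum N L k Ψ`,
`cap = (1+η)N/8^k` (the fair share, inflated by `1+η`) and `X = Σ_m (n_m - cap)₊` (truncated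
subtraction).  If `T ≥ (1-η)N` (floor) and `X ≤ ηN` (no clumping), then the coherent amplitude
`A_k = 8^{-k/2} Σ_m √n_m` is at least `((1-2η)/√(1+η))·√N`.

Proof.  For every `m`, `min(n_m, cap) = √min · √min ≤ √cap · √n_m`, and
`n_m = (n_m - cap)₊ + min(n_m, cap)` (`tsub_add_min`).  Summing, `T = X + Σ_m min(n_m, cap)`, so
`(1-2η)N = (1-η)N - ηN ≤ Σ_m min(n_m, cap) ≤ √cap · Σ_m √n_m`, and
`8^{-k/2}/√cap = 1/√((1+η)N)`.  (Clumps cost only their mass, not their square.)  The cases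
`1 - 2η ≤ 0`, `N = 0` and `Σ_m √n_m = ⊤` are trivial; otherwise everything is finite and the last
step is bookkeeping in `ℝ`.

References: folklore (elementary inequalities); the objects are those of E. H. Lieb, R. Seiringer,
J. P. Solovej, J. Yngvason, *The Mathematics of the Bose Gas and its Condensation* (2005), §1.2.
-/

noncomputable section

open MeasureTheory Filter Set
open scoped ENNReal NNReal Topology BigOperators

namespace Summit.AtomisticToContinuum.BoseEinsteinCondensation.Cruxes.TangentTransfer.Birth

open Literature.MathematicalPhysics.QuantumManyBody.BoseGas

namespace BaseAmplitude

/-- `min a c ≤ c^{1/2} · a^{1/2}` in `ℝ≥0∞`: write `min a c = (min a c)^{1/2} · (min a c)^{1/2}` and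
bound the two factors by `c^{1/2}` and `a^{1/2}`. [folklore] -/
theorem min_le_rpow_half_mul_rpow_half (a c : ℝ≥0∞) :
    min a c ≤ c ^ (1 / 2 : ℝ) * a ^ (1 / 2 : ℝ) := by
  calc min a c = (min a c) ^ (1 / 2 : ℝ) * (min a c) ^ (1 / 2 : ℝ) := by
        rw [← ENNReal.rpow_add_of_nonneg _ _ (by norm_num) (by norm_num), add_halves,
          ENNReal.rpow_one]
    _ ≤ c ^ (1 / 2 : ℝ) * a ^ (1 / 2 : ℝ) :=
        mul_le_mul' (ENNReal.rpow_le_rpow (min_le_right a c) (by norm_num))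
          (ENNReal.rpow_le_rpow (min_le_left a c) (by norm_num))

/-- `Σ_i n_i = Σ_i (n_i - c)₊ + Σ_i min(n_i, c)` in `ℝ≥0∞` (termwise `tsub_add_min`). [folklore] -/
theorem sum_eq_sum_tsub_add_sum_min {ι : Type*} (s : Finset ι) (n : ι → ℝ≥0∞) (c : ℝ≥0∞) :
    ∑ i ∈ s, n i = ∑ i ∈ s, (n i - c) + ∑ i ∈ s, min (n i) c := by
  rw [← Finset.sum_add_distrib]
  exact Finset.sum_congr rfl fun i _ => tsub_add_min.symm

/-- **The base amplitude bound, abstractly.** For `8^k` extended nonnegative reals `n_m`, a real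
`N ≥ 0` and `η > 0`: if `ofReal ((1-η)N) ≤ Σ_m n_m` and
`Σ_m (n_m - ofReal ((1+η)N/8^k))₊ ≤ ofReal (ηN)`, then
`ofReal ((1-2η)/√(1+η)) · (ofReal N)^{1/2} ≤ 8^{-k/2} · Σ_m n_m^{1/2}`. [folklore] -/
theorem amplitude_lower_bound {k : ℕ} (n : (Fin 3 → Fin (2 ^ k)) → ℝ≥0∞) {N η : ℝ} (hN : 0 ≤ N)
    (hη : 0 < η) (hT : ENNReal.ofReal ((1 - η) * N) ≤ ∑ m, n m)
    (hX : ∑ m, (n m - ENNReal.ofReal ((1 + η) * N / 8 ^ k)) ≤ ENNReal.ofReal (η * N)) :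
    ENNReal.ofReal ((1 - 2 * η) / Real.sqrt (1 + η)) * (ENNReal.ofReal N) ^ (1 / 2 : ℝ) ≤
      (8 : ℝ≥0∞) ^ (-(k : ℝ) / 2) * ∑ m, (n m) ^ (1 / 2 : ℝ) := by
  -- trivial cases: `1 - 2η ≤ 0`, `N = 0`
  rcases le_or_gt (1 - 2 * η) 0 with h2η | h2η
  · rw [ENNReal.ofReal_of_nonpos (div_nonpos_of_nonpos_of_nonneg h2η (Real.sqrt_nonneg _)),
      zero_mul]
    exact zero_le
  rcases hN.eq_or_lt with rfl | hN0
  · rw [ENNReal.ofReal_zero, ENNReal.zero_rpow_of_pos (by norm_num), mul_zero]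
    exact zero_le
  -- the cap and the fair-share constant
  set cap : ℝ≥0∞ := ENNReal.ofReal ((1 + η) * N / 8 ^ k) with hcap
  have hc : 0 < (1 + η) * N / 8 ^ k := by positivity
  -- step 1: `(1-2η)N ≤ Σ_m min(n_m, cap)`
  have h1 : ENNReal.ofReal ((1 - 2 * η) * N) ≤ ∑ m, min (n m) cap := by
    have h : ENNReal.ofReal ((1 - η) * N) ≤ ENNReal.ofReal (η * N) + ∑ m, min (n m) cap :=
      calc ENNReal.ofReal ((1 - η) * N) ≤ ∑ m, n m := hT
        _ = ∑ m, (n m - cap) + ∑ m, min (n m) cap := sum_eq_sum_tsub_add_sum_min _ _ _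
        _ ≤ ENNReal.ofReal (η * N) + ∑ m, min (n m) cap := add_le_add hX le_rfl
    have h' : (1 - 2 * η) * N = (1 - η) * N - η * N := by ring
    rw [h', ENNReal.ofReal_sub _ (by positivity)]
    exact tsub_le_iff_left.2 h
  -- step 2: `Σ_m min(n_m, cap) ≤ cap^{1/2} · Σ_m n_m^{1/2}`
  have h2 : ∑ m, min (n m) cap ≤ cap ^ (1 / 2 : ℝ) * ∑ m, (n m) ^ (1 / 2 : ℝ) := by
    rw [Finset.mul_sum]
    exact Finset.sum_le_sum fun m _ => min_le_rpow_half_mul_rpow_half (n m) cap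
  have h12 := h1.trans h2
  -- step 3: if `Σ_m n_m^{1/2} = ⊤` there is nothing to prove
  rcases eq_or_ne (∑ m, (n m) ^ (1 / 2 : ℝ)) ⊤ with hS | hS
  · rw [hS, ENNReal.mul_top (ENNReal.rpow_pos (by norm_num) (by simp)).ne']
    exact le_top
  -- step 4: everything is finite; move to `ℝ`
  obtain ⟨s, hs0, hs⟩ : ∃ s : ℝ, 0 ≤ s ∧ ∑ m, (n m) ^ (1 / 2 : ℝ) = ENNReal.ofReal s :=
    ⟨_, ENNReal.toReal_nonneg, (ENNReal.ofReal_toReal hS).symm⟩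
  have hcap' : cap ^ (1 / 2 : ℝ) = ENNReal.ofReal (Real.sqrt ((1 + η) * N / 8 ^ k)) := by
    rw [hcap, ENNReal.ofReal_rpow_of_nonneg hc.le (by norm_num), Real.sqrt_eq_rpow]
  have h8 : (8 : ℝ≥0∞) ^ (-(k : ℝ) / 2) = ENNReal.ofReal ((8 : ℝ) ^ (-(k : ℝ) / 2)) := by
    rw [← ENNReal.ofReal_rpow_of_pos (by norm_num : (0 : ℝ) < 8), ENNReal.ofReal_ofNat]
  have hNhalf : (ENNReal.ofReal N) ^ (1 / 2 : ℝ) = ENNReal.ofReal (Real.sqrt N) := by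
    rw [ENNReal.ofReal_rpow_of_nonneg hN (by norm_num), Real.sqrt_eq_rpow]
  rw [hs, hcap', ← ENNReal.ofReal_mul (Real.sqrt_nonneg _),
    ENNReal.ofReal_le_ofReal_iff (by positivity)] at h12
  rw [hs, h8, hNhalf, ← ENNReal.ofReal_mul (div_nonneg h2η.le (Real.sqrt_nonneg _)),
    ← ENNReal.ofReal_mul (by positivity)]
  refine ENNReal.ofReal_le_ofReal ?_
  -- step 5: the real bookkeeping `(1-2η)N ≤ √((1+η)N/8^k)·s ⟹ (1-2η)/√(1+η)·√N ≤ 8^{-k/2}·s`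
  have hsq : Real.sqrt ((1 + η) * N / 8 ^ k) =
      Real.sqrt (1 + η) * Real.sqrt N / Real.sqrt ((8 : ℝ) ^ k) := by
    rw [Real.sqrt_div (by positivity), Real.sqrt_mul (by positivity)]
  have h8r : (8 : ℝ) ^ (-(k : ℝ) / 2) = (Real.sqrt ((8 : ℝ) ^ k))⁻¹ := by
    rw [Real.sqrt_eq_rpow, ← Real.rpow_natCast, ← Real.rpow_mul (by norm_num),
      ← Real.rpow_neg (by norm_num)]
    congr 1
    ring
  rw [hsq] at h12
  have ha : 0 < Real.sqrt (1 + η) := Real.sqrt_pos.2 (by linarith)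
  have hb : 0 < Real.sqrt N := Real.sqrt_pos.2 hN0
  rw [h8r, div_mul_eq_mul_div, div_le_iff₀ ha]
  refine le_of_mul_le_mul_right ?_ hb
  calc (1 - 2 * η) * Real.sqrt N * Real.sqrt N = (1 - 2 * η) * N := by
        rw [mul_assoc, Real.mul_self_sqrt hN]
    _ ≤ Real.sqrt (1 + η) * Real.sqrt N / Real.sqrt ((8 : ℝ) ^ k) * s := h12
    _ = (Real.sqrt ((8 : ℝ) ^ k))⁻¹ * s * Real.sqrt (1 + η) * Real.sqrt N := by ring

end BaseAmplitude

/-- **STUB `stub_baseAmplitude` — the coherent amplitude from a floor and a no-clumping bound**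
(registered signature of the line `registered`, skeleton v2, of the crux `TangentTransfer`).  If at
level `k` the flat cell modes carry `≥ (1-η)N` particles, `ofReal ((1-η)N) ≤ cohSum N L k Ψ`, and their
total over-occupation beyond the fair share `cap = (1+η)N/8^k` is `≤ ηN`,
`Σ_m (⟨dyMode_m, γ_Ψ dyMode_m⟩ - cap)₊ ≤ ofReal (ηN)`, then the coherent amplitude
`A_k = 8^{-k/2} Σ_m ⟨dyMode_m, γ_Ψ dyMode_m⟩^{1/2}` is at least `((1-2η)/√(1+η))·√N`:
`√n ≥ min(n, cap)/√cap` and `Σ_m min(n_m, cap) = Σ_m n_m - Σ_m (n_m - cap)₊ ≥ (1-2η)N`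
(`BaseAmplitude.amplitude_lower_bound` with `n_m` the flat-mode occupations; `cohSum` unfolds by
`rfl`). [folklore] -/
theorem stub_baseAmplitude :
    ∀ (N : ℕ) (L : ℝ) (k : ℕ) (Ψ : Config N → ℂ) (η : ℝ), 0 < η →
      ENNReal.ofReal ((1 - η) * N) ≤ cohSum N L k Ψ →
      ∑ m : Fin 3 → Fin (2 ^ k),
          (occupation N (dyMode L k m) Ψ - ENNReal.ofReal ((1 + η) * N / 8 ^ k)) ≤
        ENNReal.ofReal (η * N) →
      ENNReal.ofReal ((1 - 2 * η) / Real.sqrt (1 + η)) * (N : ℝ≥0∞) ^ (1 / 2 : ℝ) ≤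
        (8 : ℝ≥0∞) ^ (-(k : ℝ) / 2) *
          ∑ m : Fin 3 → Fin (2 ^ k), (occupation N (dyMode L k m) Ψ) ^ (1 / 2 : ℝ) := by
  intro N L k Ψ η hη hT hX
  have h := BaseAmplitude.amplitude_lower_bound (fun m => occupation N (dyMode L k m) Ψ)
    (Nat.cast_nonneg N) hη hT hX
  rwa [ENNReal.ofReal_natCast] at h

end Summit.AtomisticToContinuum.BoseEinsteinCondensation.Cruxes.TangentTransfer.Birth

end
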